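import Mathlib
import HarnessLib
import Summits.HubbardSuperconductivity.HubbardSuperconductivity.Theorems.ComplexGFFStiffnessDefs
import Summits.HubbardSuperconductivity.HubbardSuperconductivity.Theorems.ComplexGFFStiffnessHypALocalTwoPointReduction
import Summits.HubbardSuperconductivity.HubbardSuperconductivity.Theorems.ComplexGFFStiffnessHypALocalTwoPointLinePert
import Summits.HubbardSuperconductivity.HubbardSuperconductivity.Theorems.ComplexGFFStiffnessHypALocalTwoPointOnePointDerivativeGrowth

/-!
# Crux `HypALocalTwoPoint`, line `gnv` — `OnePointLipschitz` from `N`-uniform first and second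
# DIFFERENCE bounds on the finite-volume free energy (`C^{1,1}` in difference form)

Route `route-HubbardSuperconductivity-ComplexGFFStiffness`, crux item stmt-HubbardSuperconductivity-19155.
This file closes the OBSERVABLE side of the reduction chain
`stub_twoPointGivenZ ⇐ OnePointLipschitz ⇐ (free-energy difference bounds)`: if on every torus
`(ℤ/L^N)^4` the perturbed partition function has a representation `pertZ n K = c·exp(f(K))` on the
`ι`-admissible ball of radius `ρ` (`IsIotaAdmissible r₀ ρ`, the reference's `E_{1/2}`-ball), with
`|f(K+U) − f(K)| ≤ C|Λ|‖U‖` and `|f(K+U+V) − f(K+U) − f(K+V) + f(K)| ≤ C|Λ|‖U‖‖V‖` (sizes of the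
directions measured by `IsIotaAdmissible r₀ δ ·`), `C` INDEPENDENT OF `N`, then `OnePointLipschitz`
holds (with radius `ρ/2` in the `exp(|z|²/8)` classes and constant `2·C·2^{r₀}(2 + ρ/2)`).

Mechanism (`…OnePointDerivativeGrowth`, `…SecondDifferences`): the one-point functions are
`s`-derivatives at `0` of `pertZ(K + sG(1+K))/pertZ(K) = exp(f(K + sG(1+K)) − f(K))`; the ratio of the
two such families at `K`, `K'` is `exp(w(s))` with
`w(s) = [f(K + sH) − f(K + sH')] + [f(K + sH') − f(K) − f(K' + sH') + f(K')]`, `H = G(1+K)`,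
`H' = G(1+K')`, `sH − sH' = sG(K − K')`: a first difference of size `|s|·2^{r₀}‖K−K'‖` plus a
parallelogram second difference of size `‖K − K'‖·|s|2^{r₀}(1+ρ/2)`, so `‖exp(w(s)) − 1‖ ≤ M|s|` with
`M = 2C|Λ|2^{r₀}(2+ρ/2)‖K−K'‖`, and (C2) turns this into `‖onePoint K G − onePoint K' G‖ ≤ M/|Λ|`.

* bookkeeping: `IsIotaAdmissible.of_size_le`, `IsIotaAdmissible.add`, `IsIotaAdmissible.real_mul`,
  `isIotaAdmissible_obs_mul_one_add`, `isIotaAdmissible_mul_wt`;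
* **`onePointLipschitz_of_freeEnergyBounds`** — the statement above.

What remains for the stub after this file: the free-energy difference bounds themselves (the
second-difference half of [ABKM19] Thm 2.2 along the tuned flow: `Literature/Dynamics/Hyperbolic/
RGFlowStableManifoldSecondDiff`, the `N`-uniform `q`-dependence of the steps, and the assembly of the
representation `pertZ = Z₀κ(q)e^{λ|Λ|}(1 + R_N)`).  All proved here; no `sorry`.

## References
* S. Adams, S. Buchholz, R. Kotecký, S. Müller, arXiv:1910.13564, Sec. 2.1, Theorem 2.2, Ch. 4
  [AdamsBuchholzKoteckyMuller2019].
-/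

noncomputable section

-- `Summit.<Summit>.<Problem>`: single-conjunct summit, the duplicate component is mandated (D-0017).
set_option linter.dupNamespace false

namespace Summit.HubbardSuperconductivity.HubbardSuperconductivity.Theorems.ComplexGFF

open scoped BigOperators ComplexConjugate Topology
open MeasureTheory Filter

variable {n : ℕ}

/-! ### Bookkeeping of the admissible classes -/

/-- monotonicity of `IsIotaAdmissible` in the size. -/
theorem IsIotaAdmissible.of_size_le {r₀ : ℕ} {ρ ρ' : ℝ} {K : (Fin 4 → ℝ) → ℂ}
    (hK : IsIotaAdmissible r₀ ρ K) (hρ : ρ ≤ ρ') : IsIotaAdmissible r₀ ρ' K := by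
  obtain ⟨hd, hb, hι⟩ := hK
  exact ⟨hd, fun k hk z => (hb k hk z).trans (mul_le_mul_of_nonneg_right hρ (Real.exp_pos _).le), hι⟩

/-- sizes add under addition. -/
theorem IsIotaAdmissible.add {r₀ : ℕ} {a b : ℝ} {U V : (Fin 4 → ℝ) → ℂ}
    (hU : IsIotaAdmissible r₀ a U) (hV : IsIotaAdmissible r₀ b V) :
    IsIotaAdmissible r₀ (a + b) (fun z => U z + V z) := by
  obtain ⟨hUd, hUb, hUι⟩ := hU
  obtain ⟨hVd, hVb, hVι⟩ := hV
  refine ⟨hUd.add hVd, fun k hk z => ?_, fun z => by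
    show U (-z) + V (-z) = conj (U z + V z)
    rw [hUι, hVι, map_add]⟩
  have hkr : (k : WithTop ℕ∞) ≤ r₀ := by exact_mod_cast hk
  have hfun : (fun z => U z + V z) = U + V := rfl
  rw [hfun, iteratedFDeriv_add_apply (hUd.of_le hkr).contDiffAt (hVd.of_le hkr).contDiffAt]
  calc ‖iteratedFDeriv ℝ k U z + iteratedFDeriv ℝ k V z‖
      ≤ ‖iteratedFDeriv ℝ k U z‖ + ‖iteratedFDeriv ℝ k V z‖ := norm_add_le _ _
    _ ≤ a * Real.exp ((∑ i : Fin 4, (z i) ^ 2) / 4) + b * Real.exp ((∑ i : Fin 4, (z i) ^ 2) / 4) :=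
        add_le_add (hUb k hk z) (hVb k hk z)
    _ = (a + b) * Real.exp ((∑ i : Fin 4, (z i) ^ 2) / 4) := by ring

/-- multiplication by a real scalar scales the size and keeps the `ι`-symmetry. -/
theorem IsIotaAdmissible.real_mul {r₀ : ℕ} {a : ℝ} {U : (Fin 4 → ℝ) → ℂ}
    (hU : IsIotaAdmissible r₀ a U) (s : ℝ) :
    IsIotaAdmissible r₀ (|s| * a) (fun z => (s : ℂ) * U z) := by
  obtain ⟨hUd, hUb, hUι⟩ := hU
  refine ⟨contDiff_const.mul hUd, fun k hk z => ?_, fun z => by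
    show (s : ℂ) * U (-z) = conj ((s : ℂ) * U z)
    rw [hUι, map_mul, Complex.conj_ofReal]⟩
  have hkr : (k : WithTop ℕ∞) ≤ r₀ := by exact_mod_cast hk
  have hfun : (fun z => (s : ℂ) * U z) = (s : ℂ) • U := by funext y; simp
  rw [hfun, iteratedFDeriv_const_smul_apply (hUd.of_le hkr).contDiffAt, norm_smul, Complex.norm_real,
    Real.norm_eq_abs, mul_assoc]
  exact mul_le_mul_of_nonneg_left (hUb k hk z) (abs_nonneg s)

/-- `G·(1+K)` is admissible (weight `exp(|z|²/4)`, size `2^{r₀}γ(1+ρ)`) for `G, K` in the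
`exp(|z|²/8)` classes. -/
theorem isIotaAdmissible_obs_mul_one_add {r₀ : ℕ} {ρ γ : ℝ} (hρ : 0 ≤ ρ) (hγ : 0 ≤ γ)
    {K G : (Fin 4 → ℝ) → ℂ} (hK : IsIotaAdmissibleWt r₀ (1 / 8) ρ K) (hG : IsIotaAdmissibleWt r₀ (1 / 8) γ G) :
    IsIotaAdmissible r₀ (2 ^ r₀ * γ * (1 + ρ)) (fun z => G z * (1 + K z)) := by
  refine ⟨hG.1.mul (contDiff_const.add hK.1), fun k hk z =>
    norm_iteratedFDeriv_obs_mul_one_add_le hρ hγ hK hG hk z, fun z => ?_⟩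
  show G (-z) * (1 + K (-z)) = conj (G z * (1 + K z))
  rw [hK.2.2 z, hG.2.2 z, map_mul, map_add, map_one]

/-- products of two functions of the `exp(|z|²/8)` classes are admissible with weight `exp(|z|²/4)`
and size `2^{r₀}γδ`. -/
theorem isIotaAdmissible_mul_wt {r₀ : ℕ} {γ δ : ℝ} (hγ : 0 ≤ γ) (hδ : 0 ≤ δ)
    {G U : (Fin 4 → ℝ) → ℂ} (hG : IsIotaAdmissibleWt r₀ (1 / 8) γ G) (hU : IsIotaAdmissibleWt r₀ (1 / 8) δ U) :
    IsIotaAdmissible r₀ (2 ^ r₀ * γ * δ) (fun z => G z * U z) := by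
  obtain ⟨hGd, hGb, hGι⟩ := hG
  obtain ⟨hUd, hUb, hUι⟩ := hU
  refine ⟨hGd.mul hUd, fun k hk z => ?_, fun z => by
    show G (-z) * U (-z) = conj (G z * U z)
    rw [hGι, hUι, map_mul]⟩
  set W : ℝ := Real.exp (1 / 8 * ∑ i : Fin 4, (z i) ^ 2) with hW
  have hWW : W * W = Real.exp ((∑ i : Fin 4, (z i) ^ 2) / 4) := by
    rw [hW, ← Real.exp_add]; congr 1; ring
  have hL := norm_iteratedFDeriv_mul_le (N := (r₀ : WithTop ℕ∞)) hGd hUd z (n := k) (by exact_mod_cast hk)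
  refine hL.trans ?_
  calc ∑ j ∈ Finset.range (k + 1), (k.choose j : ℝ) * ‖iteratedFDeriv ℝ j G z‖ *
        ‖iteratedFDeriv ℝ (k - j) U z‖
      ≤ ∑ j ∈ Finset.range (k + 1), (k.choose j : ℝ) * (γ * W) * (δ * W) := by
        refine Finset.sum_le_sum fun j hj => ?_
        have hjk : j ≤ k := Nat.lt_succ_iff.mp (Finset.mem_range.mp hj)
        have h1 := hGb j (hjk.trans hk) z
        have h2 := hUb (k - j) ((Nat.sub_le _ _).trans hk) z
        have h3 : 0 ≤ (k.choose j : ℝ) * ‖iteratedFDeriv ℝ j G z‖ := by positivity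
        calc (k.choose j : ℝ) * ‖iteratedFDeriv ℝ j G z‖ * ‖iteratedFDeriv ℝ (k - j) U z‖
            ≤ (k.choose j : ℝ) * ‖iteratedFDeriv ℝ j G z‖ * (δ * W) := mul_le_mul_of_nonneg_left h2 h3
          _ ≤ (k.choose j : ℝ) * (γ * W) * (δ * W) := by
              refine mul_le_mul_of_nonneg_right (mul_le_mul_of_nonneg_left h1 (by positivity)) ?_
              positivity
    _ = 2 ^ k * (γ * δ) * (W * W) := by
        rw [← Finset.sum_mul, ← Finset.sum_mul]
        have : ∑ j ∈ Finset.range (k + 1), (k.choose j : ℝ) = 2 ^ k := by exact_mod_cast Nat.sum_range_choose k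
        rw [this]; ring
    _ ≤ 2 ^ r₀ * (γ * δ) * (W * W) := by
        refine mul_le_mul_of_nonneg_right (mul_le_mul_of_nonneg_right
          (pow_le_pow_right₀ (by norm_num) hk) (by positivity)) (by positivity)
    _ = 2 ^ r₀ * γ * δ * Real.exp ((∑ i : Fin 4, (z i) ^ 2) / 4) := by rw [hWW]; ring

/-- the pointwise growth bound of an `exp(|z|²/8)`-admissible function. -/
theorem IsIotaAdmissibleWt.norm_le {r₀ : ℕ} {ρ : ℝ} {K : (Fin 4 → ℝ) → ℂ}
    (hK : IsIotaAdmissibleWt r₀ (1 / 8) ρ K) (z : Fin 4 → ℝ) :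
    ‖K z‖ ≤ ρ * Real.exp (1 / 8 * ∑ i : Fin 4, (z i) ^ 2) := by
  have h := hK.2.1 0 (Nat.zero_le _) z
  rwa [norm_iteratedFDeriv_zero] at h

/-! ### The reduction -/

/-- **`OnePointLipschitz` from `N`-uniform free-energy difference bounds** (module docstring). -/
theorem onePointLipschitz_of_freeEnergyBounds
    (h : ∃ r₀ : ℕ, ∃ L₀ : ℕ, ∀ L : ℕ, Odd L → L₀ ≤ L → ∃ ρ C : ℝ, 0 < ρ ∧ 0 ≤ C ∧
      ∀ N : ℕ, 1 ≤ N → ∀ (n : ℕ) [NeZero n], n = L ^ N →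
        ∃ f : ((Fin 4 → ℝ) → ℂ) → ℂ, ∃ c : ℂ,
          (∀ K, IsIotaAdmissible r₀ ρ K → pertZ n K = c * Complex.exp (f K)) ∧
          (∀ (K U : (Fin 4 → ℝ) → ℂ) (δ : ℝ), IsIotaAdmissible r₀ ρ K →
              IsIotaAdmissible r₀ ρ (fun z => K z + U z) → 0 ≤ δ → IsIotaAdmissible r₀ δ U →
              ‖f (fun z => K z + U z) - f K‖ ≤ C * (Fintype.card (Fin 4 → ZMod n) : ℝ) * δ) ∧
          (∀ (K U V : (Fin 4 → ℝ) → ℂ) (δ₁ δ₂ : ℝ), IsIotaAdmissible r₀ ρ K →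
              IsIotaAdmissible r₀ ρ (fun z => K z + U z) → IsIotaAdmissible r₀ ρ (fun z => K z + V z) →
              IsIotaAdmissible r₀ ρ (fun z => K z + U z + V z) → 0 ≤ δ₁ → 0 ≤ δ₂ →
              IsIotaAdmissible r₀ δ₁ U → IsIotaAdmissible r₀ δ₂ V →
              ‖f (fun z => K z + U z + V z) - f (fun z => K z + U z) - f (fun z => K z + V z) + f K‖
                ≤ C * (Fintype.card (Fin 4 → ZMod n) : ℝ) * δ₁ * δ₂)) :
    OnePointLipschitz := by
  obtain ⟨r₀, L₀, hL⟩ := h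
  refine ⟨r₀, L₀, fun L hodd hle => ?_⟩
  obtain ⟨ρ, C, hρ, hC, hN⟩ := hL L hodd hle
  refine ⟨ρ / 2, 2 * C * 2 ^ r₀ * (2 + ρ / 2), by positivity, ?_⟩
  intro N hN1 n _ hn K K' G δ hK hK' hG hδ hdiff hZ hZ'
  obtain ⟨f, c, hrep, hlip, hsec⟩ := hN N hN1 n hn
  have hρ2 : 0 ≤ ρ / 2 := by positivity
  set Λr : ℝ := (Fintype.card (Fin 4 → ZMod n) : ℝ) with hΛr
  have hΛ0 : 0 < Λr := Nat.cast_pos.mpr Fintype.card_pos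
  -- the perturbed interactions as functions
  set KsH : ℝ → (Fin 4 → ℝ) → ℂ := fun s z => K z + (s : ℂ) * (G z * (1 + K z)) with hKsH
  set K'sH' : ℝ → (Fin 4 → ℝ) → ℂ := fun s z => K' z + (s : ℂ) * (G z * (1 + K' z)) with hK'sH'
  set KsH' : ℝ → (Fin 4 → ℝ) → ℂ := fun s z => K z + (s : ℂ) * (G z * (1 + K' z)) with hKsH'
  -- admissibility (weight `exp(|z|²/4)`)
  have hK4 : IsIotaAdmissible r₀ (ρ / 2) K := isIotaAdmissible_of_wt_eighth hρ2 hK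
  have hK'4 : IsIotaAdmissible r₀ (ρ / 2) K' := isIotaAdmissible_of_wt_eighth hρ2 hK'
  have hU4 : IsIotaAdmissible r₀ δ (fun z => K z - K' z) := isIotaAdmissible_of_wt_eighth hδ hdiff
  set τ : ℝ := 2 ^ r₀ * 1 * (1 + ρ / 2) with hτ
  have hτ0 : 0 < τ := by positivity
  have hsH : ∀ s : ℝ, IsIotaAdmissible r₀ (|s| * τ) (fun z => (s : ℂ) * (G z * (1 + K z))) :=
    fun s => (isIotaAdmissible_obs_mul_one_add hρ2 zero_le_one hK hG).real_mul s
  have hsH' : ∀ s : ℝ, IsIotaAdmissible r₀ (|s| * τ) (fun z => (s : ℂ) * (G z * (1 + K' z))) :=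
    fun s => (isIotaAdmissible_obs_mul_one_add hρ2 zero_le_one hK' hG).real_mul s
  have hsJ : ∀ s : ℝ, IsIotaAdmissible r₀ (|s| * (2 ^ r₀ * 1 * δ)) (fun z => (s : ℂ) * (G z * (K z - K' z))) :=
    fun s => (isIotaAdmissible_mul_wt zero_le_one hδ hG hdiff).real_mul s
  -- the threshold below which all four corners are in the `ρ`-ball
  set s₀ : ℝ := (ρ / 2) / τ with hs₀
  have hs₀0 : 0 < s₀ := by positivity
  have hsmall : ∀ s : ℝ, |s| < s₀ → ρ / 2 + |s| * τ ≤ ρ := by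
    intro s hs
    have h1 : |s| * τ ≤ ρ / 2 := by
      have := (lt_div_iff₀ hτ0).mp hs
      linarith
    linarith
  have hKsH_adm : ∀ s : ℝ, |s| < s₀ → IsIotaAdmissible r₀ ρ (KsH s) :=
    fun s hs => (hK4.add (hsH s)).of_size_le (hsmall s hs)
  have hK'sH'_adm : ∀ s : ℝ, |s| < s₀ → IsIotaAdmissible r₀ ρ (K'sH' s) :=
    fun s hs => (hK'4.add (hsH' s)).of_size_le (hsmall s hs)
  have hKsH'_adm : ∀ s : ℝ, |s| < s₀ → IsIotaAdmissible r₀ ρ (KsH' s) :=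
    fun s hs => (hK4.add (hsH' s)).of_size_le (hsmall s hs)
  have hKρ : IsIotaAdmissible r₀ ρ K := hK4.of_size_le (by linarith)
  have hK'ρ : IsIotaAdmissible r₀ ρ K' := hK'4.of_size_le (by linarith)
  -- `c ≠ 0`
  have hc : c ≠ 0 := by
    intro hc0
    apply hZ
    rw [hrep K hKρ, hc0, zero_mul]
  -- the constant of the ratio bound
  set M₀ : ℝ := C * Λr * 2 ^ r₀ * (2 + ρ / 2) * δ with hM₀
  have hM₀0 : 0 ≤ M₀ := by positivity
  -- the exponent `w(s)` and its bound
  have hw : ∀ s : ℝ, |s| < s₀ →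
      ‖(f (KsH s) - f K) - (f (K'sH' s) - f K')‖ ≤ M₀ * |s| := by
    intro s hs
    -- first difference: `f(KsH) − f(KsH')`, direction `sJ = sG(K − K')`
    have e1 : (fun z => KsH' s z + (s : ℂ) * (G z * (K z - K' z))) = KsH s := by
      funext z; simp only [hKsH, hKsH']; ring
    have h1 : ‖f (KsH s) - f (KsH' s)‖ ≤ C * Λr * (|s| * (2 ^ r₀ * 1 * δ)) := by
      have h := hlip (KsH' s) (fun z => (s : ℂ) * (G z * (K z - K' z))) _ (hKsH'_adm s hs)
        (by rw [e1]; exact hKsH_adm s hs) (by positivity) (hsJ s)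
      rwa [e1] at h
    -- second difference over the parallelogram `K', K' + (K − K'), K' + sH'`
    have e2 : (fun z => K' z + (K z - K' z)) = K := by funext z; ring
    have e3 : (fun z => K' z + (s : ℂ) * (G z * (1 + K' z))) = K'sH' s := by funext z; simp only [hK'sH']
    have e4 : (fun z => K' z + (K z - K' z) + (s : ℂ) * (G z * (1 + K' z))) = KsH' s := by
      funext z; simp only [hKsH']; ring
    have h2 : ‖f (KsH' s) - f K - f (K'sH' s) + f K'‖ ≤ C * Λr * δ * (|s| * τ) := by
      have h := hsec K' (fun z => K z - K' z) (fun z => (s : ℂ) * (G z * (1 + K' z))) δ (|s| * τ) hK'ρ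
        (by rw [e2]; exact hKρ) (by rw [e3]; exact hK'sH'_adm s hs) (by rw [e4]; exact hKsH'_adm s hs)
        hδ (by positivity) hU4 (hsH' s)
      rwa [e2, e3, e4] at h
    have hsplit : (f (KsH s) - f K) - (f (K'sH' s) - f K') =
        (f (KsH s) - f (KsH' s)) + (f (KsH' s) - f K - f (K'sH' s) + f K') := by ring
    rw [hsplit]
    refine (norm_add_le _ _).trans ((add_le_add h1 h2).trans (le_of_eq ?_))
    simp only [hM₀, hτ]; ring
  -- the ratio is `exp(w(s))`
  have hratio : ∀ s : ℝ, |s| < s₀ →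
      (pertZ n (KsH s) / pertZ n K) / (pertZ n (K'sH' s) / pertZ n K')
        = Complex.exp ((f (KsH s) - f K) - (f (K'sH' s) - f K')) := by
    intro s hs
    rw [hrep _ (hKsH_adm s hs), hrep K hKρ, hrep _ (hK'sH'_adm s hs), hrep K' hK'ρ,
      Complex.exp_sub, Complex.exp_sub, Complex.exp_sub]
    have he : ∀ w : ℂ, Complex.exp w ≠ 0 := fun w => Complex.exp_ne_zero w
    field_simp
  -- the ratio bound near `s = 0`
  set s₁ : ℝ := min s₀ (1 / (M₀ + 1)) with hs₁
  have hs₁0 : 0 < s₁ := lt_min hs₀0 (by positivity)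
  have hev : ∀ᶠ s : ℝ in 𝓝 0,
      ‖(pertZ n (fun z => K z + ((s : ℝ) : ℂ) * (G z * (1 + K z))) / pertZ n K) /
          (pertZ n (fun z => K' z + ((s : ℝ) : ℂ) * (G z * (1 + K' z))) / pertZ n K') - 1‖
        ≤ (2 * M₀) * |s| := by
    filter_upwards [Metric.ball_mem_nhds (0 : ℝ) hs₁0] with s hs
    rw [Metric.mem_ball, dist_zero_right, Real.norm_eq_abs] at hs
    have hs0 : |s| < s₀ := lt_of_lt_of_le hs (min_le_left _ _)
    have hsM : |s| ≤ 1 / (M₀ + 1) := (lt_of_lt_of_le hs (min_le_right _ _)).le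
    have hw1 : ‖(f (KsH s) - f K) - (f (K'sH' s) - f K')‖ ≤ 1 := by
      refine (hw s hs0).trans ?_
      calc M₀ * |s| ≤ M₀ * (1 / (M₀ + 1)) := mul_le_mul_of_nonneg_left hsM hM₀0
        _ ≤ 1 := by rw [mul_one_div, div_le_one (by positivity)]; linarith
    have h := Complex.norm_exp_sub_one_le hw1
    show ‖(pertZ n (KsH s) / pertZ n K) / (pertZ n (K'sH' s) / pertZ n K') - 1‖ ≤ (2 * M₀) * |s|
    rw [hratio s hs0]
    calc ‖Complex.exp ((f (KsH s) - f K) - (f (K'sH' s) - f K')) - 1‖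
        ≤ 2 * ‖(f (KsH s) - f K) - (f (K'sH' s) - f K')‖ := h
      _ ≤ 2 * (M₀ * |s|) := mul_le_mul_of_nonneg_left (hw s hs0) (by norm_num)
      _ = (2 * M₀) * |s| := by ring
  -- (C1)+(C2)
  have hmain := norm_onePoint_sub_le_of_ratio_bound_growth (n := n) hK.1.continuous hK'.1.continuous hρ2
    hK.norm_le hK'.norm_le hG.1.continuous zero_le_one hG.norm_le hZ hZ' hev
  refine hmain.trans (le_of_eq ?_)
  simp only [hM₀, hΛr]
  field_simp

end Summit.HubbardSuperconductivity.HubbardSuperconductivity.Theorems.ComplexGFF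

end
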